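import Mathlib.GroupTheory.FreeGroup.NielsenSchreier
import Mathlib.Topology.Algebra.Group.Quotient
import Mathlib.Topology.Algebra.ContinuousMonoidHom
import Literature.AnabelianGeometry.EtaleTheta.Conventions
import HarnessLib

/-!
# [AbsTopI] §0 p. 8: co-free subgroups, the co-free core `H^{co-fr}`, and the index set of
# characteristic open subgroups (part 1 of the `(Q, Δ)`-co-free completion)

S. Mochizuki, *Topics in Absolute Anabelian Geometry I: Generalities* [AbsTopI] (2012), §0
"Topological Groups", manuscript p. 8 (lit key `paper:url-11ac98ba15fc`): "we shall refer to a normal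
open subgroup `H ⊆ G` such that the quotient group `G/H` is a free discrete group as co-free.  We shall
refer to a co-free subgroup `H ⊆ G` as minimal if every co-free subgroup of `G` contains `H`. [...]
Let `Π` be a topological group; `Δ` a normal closed subgroup such that every characteristic open
subgroup of finite index `H ⊆ Δ` admits a minimal co-free subgroup `H^{co-fr} ⊆ H`."

The notions "co-free" / "minimal co-free" are IMPORTED (`Literature.AnabelianGeometry.EtaleTheta.IsCofree`
/ `IsMinimalCofree`, [EtTh] §0 p. 9 = [AbsTopI] §0 p. 8 verbatim, abc-iut-L2) and used here in the
RELATIVE form needed for the completion (subgroups `K ≤ H` of an ambient `Π`, `H` with the subspace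
topology):

* `IsCofreeIn H K`, `IsMinimalCofreeIn H K` (+ uniqueness);
* `cofreeCore H := H ⊓ ⨅ {K | K co-free in H}` — EQUAL to the minimal co-free subgroup `H^{co-fr}`
  whenever `H` admits one (`cofreeCore_eq_of_isMinimalCofreeIn`), defined for every `H` (so the
  completion of the companion file `CoFreeCompletion.lean` is a total construction agreeing with print
  on the printed inputs);
* `cofreeCore_mono : H' ≤ H → cofreeCore H' ≤ cofreeCore H` — by the Nielsen–Schreier theorem
  (Mathlib `subgroupIsFreeOfIsFree`): `K ∩ H'` is co-free in `H'` when `K` is co-free in `H ⊇ H'`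
  (`IsCofreeIn.inf_of_le`).  This is what makes `H ↦ Π/H^{co-fr}` an INVERSE SYSTEM, a point print
  leaves implicit;
* `CharOpenSubgroup Δ` — the index set "`H ⊆ Δ` ranges over the characteristic open subgroups of `Δ`
  of finite index" (characteristic for the TOPOLOGICAL group `Δ`: stable under all `Δ ≃ₜ* Δ`), a
  meet-semilattice under inclusion.

HONEST FRAMING: general topology/group theory from a refereed paper's §0; nothing here bears on
[IUTchIII] Cor 3.12.
-/

noncomputable section

open Topology

universe u v

namespace Literature.AnabelianGeometry.AbsoluteAnabelian.AbsTopI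

open Literature.AnabelianGeometry.EtaleTheta (IsCofree IsMinimalCofree)

variable {P : Type u} [Group P] [TopologicalSpace P]

/-! ### Co-free subgroups of a subgroup `H ≤ Π` (relative form of [AbsTopI] §0 p. 8) -/

/-- "`K ⊆ H` is a *co-free* subgroup of `H`" ([AbsTopI] §0 p. 8: a normal open subgroup with
`H/K` a free discrete group) for subgroups `K ≤ H` of `Π`, `H` carrying the subspace topology:
`K ∩ H` viewed inside `H` (`K.subgroupOf H`) is co-free in the sense of
`Literature.AnabelianGeometry.EtaleTheta.IsCofree`. [cite: MochizukiAbsTopI2012, §0 p.8] -/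
def IsCofreeIn (H K : Subgroup P) : Prop :=
  K ≤ H ∧ ∃ hN : (K.subgroupOf H).Normal, @IsCofree H _ _ (K.subgroupOf H) hN

/-- "`K ⊆ H` is a *minimal co-free* subgroup of `H`": co-free and contained in every co-free
subgroup of `H`. [cite: MochizukiAbsTopI2012, §0 p.8] -/
def IsMinimalCofreeIn (H K : Subgroup P) : Prop :=
  IsCofreeIn H K ∧ ∀ K' : Subgroup P, IsCofreeIn H K' → K ≤ K'

/-- A co-free subgroup of `H` lies in `H`. [cite: MochizukiAbsTopI2012, §0 p.8] -/
theorem IsCofreeIn.le {H K : Subgroup P} (h : IsCofreeIn H K) : K ≤ H := h.1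

/-- "any minimal co-free subgroup [...] is necessarily unique" ([AbsTopI] §0 p. 8).
[cite: MochizukiAbsTopI2012, §0 p.8] -/
theorem IsMinimalCofreeIn.unique {H K₁ K₂ : Subgroup P} (h₁ : IsMinimalCofreeIn H K₁)
    (h₂ : IsMinimalCofreeIn H K₂) : K₁ = K₂ :=
  le_antisymm (h₁.2 K₂ h₂.1) (h₂.2 K₁ h₁.1)

/-- `H` itself is co-free in `H` (`H/H` is the free group on no generators).
[cite: MochizukiAbsTopI2012, §0 p.8] -/
theorem isCofreeIn_self (H : Subgroup P) : IsCofreeIn H H := by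
  have htop : H.subgroupOf H = ⊤ := Subgroup.subgroupOf_self H
  refine ⟨le_rfl, ?_⟩
  rw [htop]
  refine ⟨inferInstance, ⟨isOpen_univ, ?_⟩⟩
  haveI : Unique (H ⧸ (⊤ : Subgroup H)) :=
    @uniqueOfSubsingleton _ QuotientGroup.subsingleton_quotient_top 1
  exact IsFreeGroup.ofMulEquiv (MulEquiv.ofUnique (M := FreeGroup Empty) (N := H ⧸ (⊤ : Subgroup H)))

/-! ### The co-free core `⋂ {K co-free in H}` (`= H^{co-fr}` when a minimal one exists) -/

/-- The *co-free core* of `H`: the intersection (inside `H`) of all co-free subgroups of `H`.  When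
`H` admits a minimal co-free subgroup `H^{co-fr}` ([AbsTopI] §0 p. 8) this IS `H^{co-fr}`
(`cofreeCore_eq_of_isMinimalCofreeIn`); it is defined for every `H`.
[cite: MochizukiAbsTopI2012, §0 p.8] -/
def cofreeCore (H : Subgroup P) : Subgroup P :=
  H ⊓ ⨅ (K : Subgroup P) (_ : IsCofreeIn H K), K

/-- `cofreeCore H ⊆ H`. [cite: MochizukiAbsTopI2012, §0 p.8] -/
theorem cofreeCore_le (H : Subgroup P) : cofreeCore H ≤ H := inf_le_left

/-- The co-free core lies in every co-free subgroup. [cite: MochizukiAbsTopI2012, §0 p.8] -/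
theorem cofreeCore_le_of_isCofreeIn {H K : Subgroup P} (h : IsCofreeIn H K) : cofreeCore H ≤ K :=
  inf_le_right.trans (iInf₂_le K h)

/-- A subgroup contained in `H` and in every co-free subgroup of `H` lies in the co-free core.
[cite: MochizukiAbsTopI2012, §0 p.8] -/
theorem le_cofreeCore {H L : Subgroup P} (hL : L ≤ H) (h : ∀ K, IsCofreeIn H K → L ≤ K) :
    L ≤ cofreeCore H :=
  le_inf hL (le_iInf₂ h)

/-- **The co-free core is the minimal co-free subgroup** whenever the latter exists ("admits a
minimal co-free subgroup `H^{co-fr} ⊆ H`", [AbsTopI] §0 p. 8). [cite: MochizukiAbsTopI2012, §0 p.8] -/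
theorem cofreeCore_eq_of_isMinimalCofreeIn {H M : Subgroup P} (h : IsMinimalCofreeIn H M) :
    cofreeCore H = M :=
  le_antisymm (cofreeCore_le_of_isCofreeIn h.1) (le_cofreeCore h.1.le h.2)

/-- If the co-free core is itself co-free, it is the minimal co-free subgroup.
[cite: MochizukiAbsTopI2012, §0 p.8] -/
theorem isMinimalCofreeIn_cofreeCore {H : Subgroup P} (h : IsCofreeIn H (cofreeCore H)) :
    IsMinimalCofreeIn H (cofreeCore H) :=
  ⟨h, fun _ hK => cofreeCore_le_of_isCofreeIn hK⟩

/-! ### Monotonicity of the co-free core (Nielsen–Schreier) -/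

/-- Restricting a co-free subgroup: if `K` is co-free in `H` and `H' ≤ H`, then `K ⊓ H'` is co-free
in `H'` — `H'/(K ∩ H')` embeds in the free group `H/K`, so is free by the Nielsen–Schreier theorem
(Mathlib `subgroupIsFreeOfIsFree`), and `K ∩ H'` is normal and open in `H'`.  This is the step that
makes `H ↦ Π/H^{co-fr}` an inverse system in [AbsTopI] §0 p. 8. [cite: MochizukiAbsTopI2012, §0 p.8] -/
theorem IsCofreeIn.inf_of_le {H H' K : Subgroup P} (hK : IsCofreeIn H K) (hle : H' ≤ H) :
    IsCofreeIn H' (K ⊓ H') := by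
  obtain ⟨hKH, hN, hcf⟩ := hK
  -- the restriction of `H → H/K` to `H'`
  let φ : H' →* H ⧸ K.subgroupOf H := (QuotientGroup.mk' (K.subgroupOf H)).comp (Subgroup.inclusion hle)
  have hker : φ.ker = (K ⊓ H').subgroupOf H' := by
    ext x
    simp only [φ, MonoidHom.mem_ker, MonoidHom.coe_comp, QuotientGroup.coe_mk', Function.comp_apply,
      QuotientGroup.eq_one_iff, Subgroup.mem_subgroupOf, Subgroup.coe_inclusion, Subgroup.mem_inf,
      SetLike.coe_mem, and_true]
  have hNorm : ((K ⊓ H').subgroupOf H').Normal := by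
    rw [← hker]
    infer_instance
  refine ⟨inf_le_right, hNorm, ⟨?_, ?_⟩⟩
  · -- openness: `(K ⊓ H') ∩ H'` is the preimage of the open `K ∩ H ⊆ H` under `H' ↪ H`
    have hc : Continuous (Subgroup.inclusion hle) := by
      apply Continuous.subtype_mk
      exact continuous_subtype_val
    have heq : ((K ⊓ H').subgroupOf H' : Set H') = Subgroup.inclusion hle ⁻¹' (K.subgroupOf H : Set H) := by
      ext x
      simp [Subgroup.mem_subgroupOf]
    rw [heq]
    exact hcf.isOpen.preimage hc
  · -- freeness: `H'/(K ⊓ H') ≃ H'/ker φ ≃ range φ ≤ H/K`, a subgroup of a free group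
    haveI : IsFreeGroup (H ⧸ K.subgroupOf H) := hcf.isFreeGroup_quotient
    haveI : IsFreeGroup φ.range := subgroupIsFreeOfIsFree φ.range
    haveI : IsFreeGroup (H' ⧸ φ.ker) := IsFreeGroup.ofMulEquiv (QuotientGroup.quotientKerEquivRange φ).symm
    exact IsFreeGroup.ofMulEquiv (QuotientGroup.quotientMulEquivOfEq hker)

/-- **Monotonicity of the co-free core**: `H' ≤ H ⟹ cofreeCore H' ≤ cofreeCore H` (so the quotients
`Π/H^{co-fr}` form an inverse system over the `H`'s ordered by inclusion).
[cite: MochizukiAbsTopI2012, §0 p.8] -/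
theorem cofreeCore_mono {H H' : Subgroup P} (hle : H' ≤ H) : cofreeCore H' ≤ cofreeCore H := by
  refine le_cofreeCore ((cofreeCore_le H').trans hle) fun K hK => ?_
  exact (cofreeCore_le_of_isCofreeIn (hK.inf_of_le hle)).trans inf_le_left

/-! ### The index set: characteristic open subgroups of finite index of `Δ` -/

/-- The index set of the inverse limit of [AbsTopI] §0 p. 8: "`H ⊆ Δ` ranges over the characteristic
open subgroups of `Δ` of finite index" — subgroups `H ≤ Δ` of `P` that are open and of finite index
in `Δ` (subspace topology) and CHARACTERISTIC for the topological group `Δ`, i.e. stable under every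
automorphism `Δ ≃ₜ* Δ` of topological groups (the structure of `Δ` in play; for profinite `Δ` this is
the reading under which §0 p. 9 "the topology of `G` admits a basis of characteristic open subgroups"
holds). [cite: MochizukiAbsTopI2012, §0 p.8] -/
structure CharOpenSubgroup (Δ : Subgroup P) : Type u where
  /-- the subgroup `H`, as a subgroup of the ambient `P` -/
  toSubgroup : Subgroup P
  /-- `H ⊆ Δ` -/
  le : toSubgroup ≤ Δ
  /-- `H` is open in `Δ` -/
  isOpen : IsOpen ((toSubgroup.subgroupOf Δ : Subgroup Δ) : Set Δ)
  /-- `H` has finite index in `Δ` -/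
  finiteIndex : (toSubgroup.subgroupOf Δ).FiniteIndex
  /-- `H` is characteristic in the topological group `Δ` -/
  map_eq : ∀ α : Δ ≃ₜ* Δ, (toSubgroup.subgroupOf Δ).map α.toMulEquiv.toMonoidHom = toSubgroup.subgroupOf Δ

namespace CharOpenSubgroup

variable {Δ : Subgroup P}

/-- Index elements are determined by their subgroup. [cite: MochizukiAbsTopI2012, §0 p.8] -/
theorem toSubgroup_injective : Function.Injective (toSubgroup : CharOpenSubgroup Δ → Subgroup P) := by
  rintro ⟨H, _, _, _, _⟩ ⟨H', _, _, _, _⟩ h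
  cases h
  rfl

/-- The index set is ordered by inclusion of subgroups. [cite: MochizukiAbsTopI2012, §0 p.8] -/
instance instPartialOrder : PartialOrder (CharOpenSubgroup Δ) :=
  PartialOrder.lift toSubgroup toSubgroup_injective

/-- `H' ≤ H` in the index set means `H' ⊆ H`. [cite: MochizukiAbsTopI2012, §0 p.8] -/
theorem le_iff {H H' : CharOpenSubgroup Δ} : H' ≤ H ↔ H'.toSubgroup ≤ H.toSubgroup := Iff.rfl

omit [TopologicalSpace P] in
/-- `(A ⊓ B) ∩ C = (A ∩ C) ⊓ (B ∩ C)` inside `C`. [cite: MochizukiAbsTopI2012, §0 p.8] -/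
theorem subgroupOf_inf (A B C : Subgroup P) :
    (A ⊓ B).subgroupOf C = A.subgroupOf C ⊓ B.subgroupOf C :=
  Subgroup.comap_inf A B C.subtype

/-- The intersection of two characteristic open subgroups of finite index is again one: the index set
is a meet-semilattice (in particular DIRECTED, which is what makes the inverse limit well behaved).
[cite: MochizukiAbsTopI2012, §0 p.8] -/
def inf (H₁ H₂ : CharOpenSubgroup Δ) : CharOpenSubgroup Δ where
  toSubgroup := H₁.toSubgroup ⊓ H₂.toSubgroup
  le := inf_le_left.trans H₁.le
  isOpen := by
    rw [subgroupOf_inf, Subgroup.coe_inf]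
    exact H₁.isOpen.inter H₂.isOpen
  finiteIndex := by
    haveI : (H₁.toSubgroup.subgroupOf Δ).FiniteIndex := H₁.finiteIndex
    haveI : (H₂.toSubgroup.subgroupOf Δ).FiniteIndex := H₂.finiteIndex
    rw [subgroupOf_inf]
    infer_instance
  map_eq α := by
    rw [subgroupOf_inf, Subgroup.map_inf _ _ _ α.toMulEquiv.injective, H₁.map_eq α, H₂.map_eq α]

/-- The index set is a meet-semilattice under inclusion. [cite: MochizukiAbsTopI2012, §0 p.8] -/
instance instSemilatticeInf : SemilatticeInf (CharOpenSubgroup Δ) :=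
  { CharOpenSubgroup.instPartialOrder with
    inf := CharOpenSubgroup.inf
    inf_le_left := fun a b => show a.toSubgroup ⊓ b.toSubgroup ≤ a.toSubgroup from inf_le_left
    inf_le_right := fun a b => show a.toSubgroup ⊓ b.toSubgroup ≤ b.toSubgroup from inf_le_right
    le_inf := fun a b c h₁ h₂ => show a.toSubgroup ≤ b.toSubgroup ⊓ c.toSubgroup from le_inf h₁ h₂ }

/-- The subgroup underlying a meet. [cite: MochizukiAbsTopI2012, §0 p.8] -/
@[simp] theorem toSubgroup_inf (H₁ H₂ : CharOpenSubgroup Δ) :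
    (H₁ ⊓ H₂).toSubgroup = H₁.toSubgroup ⊓ H₂.toSubgroup := rfl

end CharOpenSubgroup

end Literature.AnabelianGeometry.AbsoluteAnabelian.AbsTopI
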